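import Literature.Analysis.FluidPDE.ClassicalLocalEnergyNoJump
import Literature.Analysis.FluidPDE.SereginSverakPressureProofs
import HarnessLib

set_option linter.dupNamespace false

/-!
# The local energy flux of the item's solution is integrable up to the blow-up time

Summits-side helper file for the crux `TerminalTrace.TypeITraceScarL3`
(item `stmt-NavierStokesRegularity-18385`; Navier–Stokes regularity is **not** proved here and
this file does not close the item). It serves the survivor portrait of the crux: the
"no anomalous dissipation at a Type-I blow-up time" statement (Leslie–Shvydkoy 2018, Thm. 1.2,
energy equality for Type-I-in-time blow-up — known in print in substance; the tree's route is
formal) needs, besides the no-concentration of the local kinetic energy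
(`tendsto_localEnergy_sub_top`, file `…NoConcentrationViscosity.lean`), that the **local energy
flux** `F_φ(s) = ∫ (νΔφ|u|² + Dφ(u)|u|² + 2 p Dφ(u))(s)` of the classical solution be integrable on
the whole life span `(0, T)`, so that the cut-off energy balance can be passed to the limit
`t ↑ T`. This file proves exactly that, for the binders of the item (classical on `[0,T)`,
Leray–Hopf on `[0,T)`), **without** any Type-I hypothesis:

* `abs_integral_flux_le` — the two-sided form of the tree's pointwise flux bound
  `IsClassicalNSSolutionOn.integral_flux_le` (apply it to `φ` and to `−φ`):
  `|F_φ(t)| ≤ |ν|∫|Δφ||u|² + ∫‖Dφ‖|u|³ + 2∫|p − c|‖Dφ‖|u|` for every gauge constant `c`;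
* `integrableOn_flux_Ioo` — `F_φ ∈ L¹(0, T)`: measurability from the continuity of `F_φ` below `T`
  (`continuousOn_integral_flux_cutoff`), finiteness of `∫₀ᵀ |F_φ|` from the Leray–Hopf energy
  bound (`∫|u(t)|² ≤ C` a.e.), the slice-wise Lebesgue-interpolation bound
  `∫|u(t)|³ ≤ c(1 + ∫|∇u(t)|²)` with `∫₀ᵀ∫|∇u|² < ∞`
  (`SereginSverak2002.exists_ae_lintegral_enorm_pow_three_le`), the pressure gauge
  `p(t,·) − c(t) = p̃[u(t)]` for a.e. `t` (`SereginSverak2002.exists_pressure_gauge_of_classical`)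
  with Stein's bound `∫|p̃[u(t)]|^{3/2} ≤ C₀∫|u(t)|³` (`lintegral_normalisedPressure_rpow_le`), and
  Young's inequality `|q||u| ≤ |q|^{3/2} + |u|³`. Everything is estimated inside lower Lebesgue
  integrals, so no measurability of the slice functionals in `t` is needed.

## References

* T. M. Leslie, R. Shvydkoy, *Conditions implying energy equality for weak solutions of the
  Navier–Stokes equations*, SIAM J. Math. Anal. 50 (2018), Thm. 1.2, §4. [LeslieShvydkoy2017]
* L. Caffarelli, R. Kohn, L. Nirenberg, CPAM 35 (1982), §2 (2.5). [CaffarelliKohnNirenberg1982]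
* G. Seregin, V. Šverák, ARMA 163 (2002), §3 (the global `L³`/`L^{3/2}` integrability of
  `u`, `p̃`). [SereginSverak2002]
-/

noncomputable section

open MeasureTheory TopologicalSpace Set Function Filter Metric
open _root_.Topology
open scoped Laplacian InnerProductSpace RealInnerProductSpace ENNReal NNReal ContDiff

namespace Summit.NavierStokesRegularity.NavierStokesRegularity.Theorems.TypeITraceScarL3

open Literature.Analysis.FluidPDE

/-- **Two-sided pointwise flux bound.** For a classical solution of the unforced system on a time
set `S`, `t ∈ S`, `φ ∈ C_c^∞(E)` and every constant `c`:
`|∫ (νΔφ|u|² + Dφ(u)|u|² + 2 p Dφ(u))(t)| ≤ |ν| ∫ |Δφ| |u(t)|² + ∫ ‖Dφ‖ |u(t)|³ + 2 ∫ |p(t) − c| ‖Dφ‖ |u(t)|`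
(the tree's one-sided `IsClassicalNSSolutionOn.integral_flux_le` applied to `φ` and to `−φ`,
whose flux is the negative of that of `φ` and whose bound is the same). [folklore; cite:
CaffarelliKohnNirenberg1982, §2 (2.5)] -/
theorem abs_integral_flux_le {E : Type*} [NormedAddCommGroup E] [InnerProductSpace ℝ E]
    [FiniteDimensional ℝ E] [MeasurableSpace E] [BorelSpace E]
    {S : Set ℝ} {ν : ℝ} {u : ℝ → E → E} {p : ℝ → E → ℝ}
    (h : IsClassicalNSSolutionOn S ν 0 u p) {φ : E → ℝ} (hφ : ContDiff ℝ ∞ φ)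
    (hφc : HasCompactSupport φ) {t : ℝ} (ht : t ∈ S) (c : ℝ) :
    |∫ x, (ν * ((Δ φ) x * ‖u t x‖ ^ 2) +
        fderiv ℝ φ x (u t x) * ‖u t x‖ ^ 2 + 2 * (p t x * fderiv ℝ φ x (u t x)))| ≤
      |ν| * (∫ x, |(Δ φ) x| * ‖u t x‖ ^ 2) + (∫ x, ‖fderiv ℝ φ x‖ * ‖u t x‖ ^ 3) +
        2 * ∫ x, |p t x - c| * ‖fderiv ℝ φ x‖ * ‖u t x‖ := by
  have h1 := h.integral_flux_le hφ hφc ht c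
  have h2 := h.integral_flux_le (φ := -φ) hφ.neg hφc.neg ht c
  have hΔ : ∀ x, (Δ (-φ)) x = -((Δ φ) x) := fun x => by
    rw [InnerProductSpace.laplacian_neg]; rfl
  have hD : ∀ x, fderiv ℝ (-φ) x = -(fderiv ℝ φ x) := fun x => fderiv_neg
  have hDv : ∀ x v, fderiv ℝ (-φ) x v = -(fderiv ℝ φ x v) := fun x v => by rw [hD]; rfl
  have hflux : ∫ x, (ν * ((Δ (-φ)) x * ‖u t x‖ ^ 2) +
      fderiv ℝ (-φ) x (u t x) * ‖u t x‖ ^ 2 + 2 * (p t x * fderiv ℝ (-φ) x (u t x))) =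
      -∫ x, (ν * ((Δ φ) x * ‖u t x‖ ^ 2) +
        fderiv ℝ φ x (u t x) * ‖u t x‖ ^ 2 + 2 * (p t x * fderiv ℝ φ x (u t x))) := by
    rw [← integral_neg]
    refine integral_congr_ae (Eventually.of_forall fun x => ?_)
    simp only [hΔ, hDv]
    ring
  have hB1 : ∫ x, |(Δ (-φ)) x| * ‖u t x‖ ^ 2 = ∫ x, |(Δ φ) x| * ‖u t x‖ ^ 2 := by
    simp only [hΔ, abs_neg]
  have hB2 : ∫ x, ‖fderiv ℝ (-φ) x‖ * ‖u t x‖ ^ 3 = ∫ x, ‖fderiv ℝ φ x‖ * ‖u t x‖ ^ 3 := by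
    simp only [hD, norm_neg]
  have hB3 : ∫ x, |p t x - c| * ‖fderiv ℝ (-φ) x‖ * ‖u t x‖ =
      ∫ x, |p t x - c| * ‖fderiv ℝ φ x‖ * ‖u t x‖ := by
    simp only [hD, norm_neg]
  rw [hflux, hB1, hB2, hB3] at h2
  exact abs_le.2 ⟨by linarith, h1⟩

/-- `ofReal (∫ f) ≤ ∫⁻ ofReal f` for a nonnegative a.e.-strongly measurable real function (equality
when `f` is integrable, `0 ≤ …` otherwise). [folklore] -/
theorem ofReal_integral_le_lintegral_ofReal {X : Type*} [MeasurableSpace X] {μ : Measure X}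
    {f : X → ℝ} (hf : ∀ x, 0 ≤ f x) (hfm : AEStronglyMeasurable f μ) :
    ENNReal.ofReal (∫ x, f x ∂μ) ≤ ∫⁻ x, ENNReal.ofReal (f x) ∂μ := by
  rw [integral_eq_lintegral_of_nonneg_ae (Eventually.of_forall hf) hfm]
  exact ENNReal.ofReal_toReal_le

/-- **The local energy flux is integrable on the whole life span.** Let `(u, p)` be a classical
solution of the unforced Navier–Stokes system with viscosity `ν > 0` on `[0, T) × ℝ³` which is a
Leray–Hopf solution on `[0, T)` (the binders of the item `TerminalTrace.TypeITraceScarL3`; no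
Type-I hypothesis, no decay of the datum), and `φ ∈ C_c^∞(ℝ³)`. Then the local energy flux
`s ↦ ∫ (νΔφ |u(s)|² + Dφ(u(s))|u(s)|² + 2 p(s) Dφ(u(s)))` is integrable on `(0, T)`.
Proof: continuity below `T`; `|F_φ| ≤ |ν|‖Δφ‖_∞ ∫|u|² + ‖Dφ‖_∞ (3∫|u|³ + 2∫|p − c(t)|^{3/2})`
(two-sided flux bound, gauge freedom, Young); `∫|u(t)|² ≤ C` (Leray–Hopf),
`∫|u(t)|³ ≤ c(1 + ∫|∇u(t)|²)` a.e. with `∫₀ᵀ∫|∇u|² < ∞` (Lebesgue interpolation),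
`∫|p(t) − c(t)|^{3/2} = ∫|p̃[u(t)]|^{3/2} ≤ C₀ ∫|u(t)|³` a.e. (pressure gauge, Stein).
[cite: LeslieShvydkoy2017, Thm. 1.2 and §4 (energy equality under Type-I control — the use made of
this lemma); SereginSverak2002, §3; CaffarelliKohnNirenberg1982, §2 (2.5)] -/
theorem integrableOn_flux_Ioo {ν T : ℝ} (hν : 0 < ν) (hT : 0 < T)
    {u : ℝ → EuclideanSpace ℝ (Fin 3) → EuclideanSpace ℝ (Fin 3)}
    {p : ℝ → EuclideanSpace ℝ (Fin 3) → ℝ}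
    (hcl : IsClassicalNSSolutionOn (Set.Ico 0 T) ν 0 u p) (hLH : IsLerayHopfOn T ν 0 (u 0) u)
    {φ : EuclideanSpace ℝ (Fin 3) → ℝ} (hφ : ContDiff ℝ ∞ φ) (hφc : HasCompactSupport φ) :
    IntegrableOn (fun s => ∫ x, (ν * ((Δ φ) x * ‖u s x‖ ^ 2) +
      fderiv ℝ φ x (u s x) * ‖u s x‖ ^ 2 + 2 * (p s x * fderiv ℝ φ x (u s x)))) (Ioo 0 T) := by
  -- the classical solution on the open time set `(0, T)`
  have hcl' : IsClassicalNSSolutionOn (Ioo 0 T) ν 0 u p :=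
    hcl.mono Ioo_subset_Ico_self isOpen_Ioo.uniqueDiffOn
  -- Step 0: measurability, from continuity below `T`
  have hcont := hcl'.continuousOn_integral_flux_cutoff hφ hφc
  refine ⟨hcont.aestronglyMeasurable measurableSet_Ioo, ?_⟩
  -- Step 1: the sup norms of `Δφ` and `Dφ`
  have hφ2 : ContDiff ℝ 2 φ := hφ.of_le (by norm_cast)
  have hφ1 : ContDiff ℝ 1 φ := hφ.of_le (by norm_cast)
  have hΔφ : Continuous (Δ φ) := continuous_laplacian hφ2
  have hDφ : Continuous (fderiv ℝ φ) := hφ1.continuous_fderiv one_ne_zero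
  have hΔc : HasCompactSupport (Δ φ) :=
    HasCompactSupport.intro hφc fun x hx => laplacian_eq_zero_of_notMem_tsupport hx
  obtain ⟨A, hA⟩ := hΔφ.bounded_above_of_compact_support hΔc
  obtain ⟨B, hB⟩ := hDφ.bounded_above_of_compact_support (hφc.fderiv (𝕜 := ℝ))
  have hA0 : 0 ≤ A := (norm_nonneg _).trans (hA 0)
  have hB0 : 0 ≤ B := (norm_nonneg _).trans (hB 0)
  -- Young's inequality with exponents `3/2` and `3`, constants dropped (the tree has it as
  -- `SereginZoomReduction.mul_le_rpow_threeHalves_add_pow_three` in another route's cone; inlined)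
  have young : ∀ a b : ℝ, 0 ≤ a → 0 ≤ b → a * b ≤ a ^ (3 / 2 : ℝ) + b ^ 3 := by
    intro a b ha hb
    have hpq : (3 / 2 : ℝ).HolderConjugate 3 := by
      rw [Real.holderConjugate_iff]; norm_num
    have hy := Real.young_inequality_of_nonneg ha hb hpq
    have h3 : b ^ (3 : ℝ) = b ^ (3 : ℕ) := by exact_mod_cast Real.rpow_natCast b 3
    rw [h3] at hy
    have h1 : 0 ≤ a ^ (3 / 2 : ℝ) := Real.rpow_nonneg ha _
    have h2 : 0 ≤ b ^ 3 := pow_nonneg hb 3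
    have e1 : a ^ (3 / 2 : ℝ) / (3 / 2) = (2 / 3) * a ^ (3 / 2 : ℝ) := by ring
    have e2 : b ^ 3 / 3 = (1 / 3) * b ^ 3 := by ring
    rw [e1, e2] at hy
    linarith
  -- Step 2: the Leray–Hopf data: energy bound, slice-wise `L³` bound, pressure gauge
  obtain ⟨CE, hCE⟩ := hLH.energy_bound
  obtain ⟨c, G, hct, hint, hslice⟩ := SereginSverak2002.exists_ae_lintegral_enorm_pow_three_le hν hLH
  obtain ⟨hgauge, -⟩ := SereginSverak2002.exists_pressure_gauge_of_classical hν hT hcl hLH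
  set C₀ : ℝ≥0∞ := (steinConstThreeHalves : ℝ≥0∞) ^ (3 / 2 : ℝ) with hC₀
  have hC₀t : C₀ ≠ ⊤ := ENNReal.rpow_ne_top_of_nonneg (by norm_num) ENNReal.coe_ne_top
  -- the two constants of the final bound `‖F(t)‖ₑ ≤ K₁ + K₂ (1 + ∫ |∇u(t)|²)`
  set K₁ : ℝ≥0∞ := ENNReal.ofReal |ν| * (ENNReal.ofReal A * CE) with hK₁
  set K₂ : ℝ≥0∞ := (ENNReal.ofReal B + 2 * (ENNReal.ofReal B * (C₀ + 1))) * c with hK₂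
  have hK₁t : K₁ ≠ ⊤ := ENNReal.mul_ne_top ENNReal.ofReal_ne_top
    (ENNReal.mul_ne_top ENNReal.ofReal_ne_top ENNReal.coe_ne_top)
  have hK₂t : K₂ ≠ ⊤ := by
    refine ENNReal.mul_ne_top (ENNReal.add_ne_top.2 ⟨ENNReal.ofReal_ne_top, ?_⟩) hct
    exact ENNReal.mul_ne_top (by norm_num)
      (ENNReal.mul_ne_top ENNReal.ofReal_ne_top (ENNReal.add_ne_top.2 ⟨hC₀t, ENNReal.one_ne_top⟩))
  -- Step 3: the pointwise-in-time bound, for a.e. `t ∈ (0, T)`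
  have hpt : ∀ᵐ t ∂(volume.restrict (Ioo 0 T)),
      ‖∫ x, (ν * ((Δ φ) x * ‖u t x‖ ^ 2) + fderiv ℝ φ x (u t x) * ‖u t x‖ ^ 2 +
        2 * (p t x * fderiv ℝ φ x (u t x)))‖ₑ ≤
      K₁ + K₂ * (1 + ∫⁻ x, ENNReal.ofReal (frobeniusNormSq (G t x))) := by
    filter_upwards [hCE, hslice, hgauge, ae_restrict_mem measurableSet_Ioo] with t hE h3 hg htI
    set D : ℝ≥0∞ := ∫⁻ x, ENNReal.ofReal (frobeniusNormSq (G t x)) with hDdef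
    set c₀ : ℝ := p t 0 - normalisedPressure (u t) 0 with hc₀
    have hu : Continuous (u t) := (hcl.contDiff_velocity ⟨htI.1.le, htI.2⟩).continuous
    have hpc : Continuous (p t) := (hcl.contDiff_pressure ⟨htI.1.le, htI.2⟩).continuous
    -- the three slice quantities, in `ℝ≥0∞`
    have hU : ∫⁻ x, ‖u t x‖ₑ ^ (3 : ℕ) ≤ c * (1 + D) := h3
    have hE2 : ∫⁻ x, ‖u t x‖ₑ ^ 2 ≤ CE := by simpa [eEnergy] using hE
    have hQ : ∫⁻ x, ‖p t x - c₀‖ₑ ^ (3 / 2 : ℝ) ≤ C₀ * (c * (1 + D)) := by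
      have hsm : ContDiff ℝ (⊤ : ℕ∞) (u t) := hcl.contDiff_velocity ⟨htI.1.le, htI.2⟩
      have hL2 : Integrable fun y => ‖u t y‖ ^ 2 :=
        (hLH.memLp t ⟨htI.1.le, htI.2.le⟩).integrable_norm_pow two_ne_zero
      calc ∫⁻ x, ‖p t x - c₀‖ₑ ^ (3 / 2 : ℝ)
          = ∫⁻ x, ‖normalisedPressure (u t) x‖ₑ ^ (3 / 2 : ℝ) := by simp only [hg]
        _ ≤ C₀ * ∫⁻ x, ‖u t x‖ₑ ^ (3 : ℕ) :=
            SereginSverak2002.lintegral_normalisedPressure_rpow_le hsm hL2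
        _ ≤ C₀ * (c * (1 + D)) := by gcongr
    -- (i) the Laplacian term
    have b1 : ENNReal.ofReal (|ν| * ∫ x, |(Δ φ) x| * ‖u t x‖ ^ 2) ≤ K₁ := by
      rw [ENNReal.ofReal_mul (abs_nonneg ν), hK₁]
      gcongr
      calc ENNReal.ofReal (∫ x, |(Δ φ) x| * ‖u t x‖ ^ 2)
          ≤ ∫⁻ x, ENNReal.ofReal (|(Δ φ) x| * ‖u t x‖ ^ 2) :=
            ofReal_integral_le_lintegral_ofReal
              (fun x => mul_nonneg (abs_nonneg _) (pow_nonneg (norm_nonneg _) _))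
              ((continuous_abs.comp hΔφ).mul (hu.norm.pow 2)).aestronglyMeasurable
        _ ≤ ∫⁻ x, ENNReal.ofReal A * ‖u t x‖ₑ ^ 2 := by
            refine lintegral_mono fun x => ?_
            rw [ENNReal.ofReal_mul (abs_nonneg _), ← ofReal_norm,
              ← ENNReal.ofReal_pow (norm_nonneg _)]
            exact mul_le_mul_left
              (ENNReal.ofReal_le_ofReal ((Real.norm_eq_abs _).symm.trans_le (hA x))) _
        _ = ENNReal.ofReal A * ∫⁻ x, ‖u t x‖ₑ ^ 2 :=
            lintegral_const_mul' _ _ ENNReal.ofReal_ne_top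
        _ ≤ ENNReal.ofReal A * CE := by gcongr
    -- (ii) the cubic term
    have b2 : ENNReal.ofReal (∫ x, ‖fderiv ℝ φ x‖ * ‖u t x‖ ^ 3) ≤
        ENNReal.ofReal B * (c * (1 + D)) := by
      calc ENNReal.ofReal (∫ x, ‖fderiv ℝ φ x‖ * ‖u t x‖ ^ 3)
          ≤ ∫⁻ x, ENNReal.ofReal (‖fderiv ℝ φ x‖ * ‖u t x‖ ^ 3) :=
            ofReal_integral_le_lintegral_ofReal
              (fun x => mul_nonneg (norm_nonneg _) (pow_nonneg (norm_nonneg _) _))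
              (hDφ.norm.mul (hu.norm.pow 3)).aestronglyMeasurable
        _ ≤ ∫⁻ x, ENNReal.ofReal B * ‖u t x‖ₑ ^ (3 : ℕ) := by
            refine lintegral_mono fun x => ?_
            rw [ENNReal.ofReal_mul (norm_nonneg _), ← ofReal_norm,
              ← ENNReal.ofReal_pow (norm_nonneg _)]
            exact mul_le_mul_left (ENNReal.ofReal_le_ofReal (hB x)) _
        _ = ENNReal.ofReal B * ∫⁻ x, ‖u t x‖ₑ ^ (3 : ℕ) :=
            lintegral_const_mul' _ _ ENNReal.ofReal_ne_top
        _ ≤ ENNReal.ofReal B * (c * (1 + D)) := by gcongr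
    -- (iii) the pressure term, after Young
    have b3 : ENNReal.ofReal (∫ x, |p t x - c₀| * ‖fderiv ℝ φ x‖ * ‖u t x‖) ≤
        ENNReal.ofReal B * ((C₀ + 1) * (c * (1 + D))) := by
      have hmeas : Measurable fun x => ‖p t x - c₀‖ₑ ^ (3 / 2 : ℝ) :=
        (hpc.sub continuous_const).measurable.enorm.pow_const _
      calc ENNReal.ofReal (∫ x, |p t x - c₀| * ‖fderiv ℝ φ x‖ * ‖u t x‖)
          ≤ ∫⁻ x, ENNReal.ofReal (|p t x - c₀| * ‖fderiv ℝ φ x‖ * ‖u t x‖) :=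
            ofReal_integral_le_lintegral_ofReal
              (fun x => mul_nonneg (mul_nonneg (abs_nonneg _) (norm_nonneg _)) (norm_nonneg _))
              (((continuous_abs.comp (hpc.sub continuous_const)).mul hDφ.norm).mul
                hu.norm).aestronglyMeasurable
        _ ≤ ∫⁻ x, ENNReal.ofReal B * (‖p t x - c₀‖ₑ ^ (3 / 2 : ℝ) + ‖u t x‖ₑ ^ (3 : ℕ)) := by
            refine lintegral_mono fun x => ?_
            have hy := young _ _ (abs_nonneg (p t x - c₀)) (norm_nonneg (u t x))
            have hle : |p t x - c₀| * ‖fderiv ℝ φ x‖ * ‖u t x‖ ≤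
                B * (|p t x - c₀| ^ (3 / 2 : ℝ) + ‖u t x‖ ^ 3) := by
              calc |p t x - c₀| * ‖fderiv ℝ φ x‖ * ‖u t x‖
                  = ‖fderiv ℝ φ x‖ * (|p t x - c₀| * ‖u t x‖) := by ring
                _ ≤ B * (|p t x - c₀| ^ (3 / 2 : ℝ) + ‖u t x‖ ^ 3) :=
                    mul_le_mul (hB x) hy (mul_nonneg (abs_nonneg _) (norm_nonneg _)) hB0
            refine (ENNReal.ofReal_le_ofReal hle).trans (le_of_eq ?_)
            rw [ENNReal.ofReal_mul hB0, ENNReal.ofReal_add (Real.rpow_nonneg (abs_nonneg _) _)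
              (pow_nonneg (norm_nonneg _) 3), ← ENNReal.ofReal_rpow_of_nonneg (abs_nonneg _)
              (by norm_num : (0 : ℝ) ≤ 3 / 2), ← Real.enorm_eq_ofReal_abs,
              ENNReal.ofReal_pow (norm_nonneg _), ofReal_norm]
        _ = ENNReal.ofReal B * ((∫⁻ x, ‖p t x - c₀‖ₑ ^ (3 / 2 : ℝ)) +
              ∫⁻ x, ‖u t x‖ₑ ^ (3 : ℕ)) := by
            rw [lintegral_const_mul' _ _ ENNReal.ofReal_ne_top, lintegral_add_left hmeas]
        _ ≤ ENNReal.ofReal B * (C₀ * (c * (1 + D)) + c * (1 + D)) := by gcongr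
        _ = ENNReal.ofReal B * ((C₀ + 1) * (c * (1 + D))) := by rw [add_mul, one_mul]
    -- assemble
    have hab := abs_integral_flux_le hcl' hφ hφc htI c₀
    have hnn1 : 0 ≤ |ν| * ∫ x, |(Δ φ) x| * ‖u t x‖ ^ 2 :=
      mul_nonneg (abs_nonneg ν) (integral_nonneg fun x => by positivity)
    have hnn2 : 0 ≤ ∫ x, ‖fderiv ℝ φ x‖ * ‖u t x‖ ^ 3 := integral_nonneg fun x => by positivity
    have hnn3 : 0 ≤ ∫ x, |p t x - c₀| * ‖fderiv ℝ φ x‖ * ‖u t x‖ :=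
      integral_nonneg fun x => by positivity
    rw [Real.enorm_eq_ofReal_abs]
    calc ENNReal.ofReal |∫ x, (ν * ((Δ φ) x * ‖u t x‖ ^ 2) + fderiv ℝ φ x (u t x) * ‖u t x‖ ^ 2 +
            2 * (p t x * fderiv ℝ φ x (u t x)))|
        ≤ ENNReal.ofReal (|ν| * (∫ x, |(Δ φ) x| * ‖u t x‖ ^ 2) +
            (∫ x, ‖fderiv ℝ φ x‖ * ‖u t x‖ ^ 3) +
            2 * ∫ x, |p t x - c₀| * ‖fderiv ℝ φ x‖ * ‖u t x‖) := ENNReal.ofReal_le_ofReal hab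
      _ = ENNReal.ofReal (|ν| * ∫ x, |(Δ φ) x| * ‖u t x‖ ^ 2) +
            ENNReal.ofReal (∫ x, ‖fderiv ℝ φ x‖ * ‖u t x‖ ^ 3) +
            2 * ENNReal.ofReal (∫ x, |p t x - c₀| * ‖fderiv ℝ φ x‖ * ‖u t x‖) := by
          rw [ENNReal.ofReal_add (add_nonneg hnn1 hnn2) (by positivity),
            ENNReal.ofReal_add hnn1 hnn2, ENNReal.ofReal_mul (by norm_num : (0:ℝ) ≤ 2),
            ENNReal.ofReal_ofNat]
      _ ≤ K₁ + ENNReal.ofReal B * (c * (1 + D)) +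
            2 * (ENNReal.ofReal B * ((C₀ + 1) * (c * (1 + D)))) := by gcongr
      _ = K₁ + K₂ * (1 + D) := by rw [hK₂]; ring
  -- Step 4: integrate the bound over `(0, T)`
  rw [hasFiniteIntegral_iff_enorm]
  refine lt_of_le_of_lt (lintegral_mono_ae hpt) ?_
  rw [lintegral_add_left measurable_const, setLIntegral_const, lintegral_const_mul' _ _ hK₂t,
    lintegral_add_left measurable_const, setLIntegral_const, one_mul]
  have hvol : volume (Ioo (0 : ℝ) T) < ⊤ := by
    rw [Real.volume_Ioo]; exact ENNReal.ofReal_lt_top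
  refine ENNReal.add_lt_top.2 ⟨ENNReal.mul_lt_top hK₁t.lt_top hvol, ?_⟩
  exact ENNReal.mul_lt_top hK₂t.lt_top (ENNReal.add_lt_top.2 ⟨hvol, hint⟩)

end Summit.NavierStokesRegularity.NavierStokesRegularity.Theorems.TypeITraceScarL3

end
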